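import Mathlib
import Summits.QuantumFields.BalabanUV.Beta.FP.TorusSupersolutionAlgebra

/-!
# Road «FP», row IR-5′ (c′) — FILE F3b: an EXPLICIT LATTICE SUPERSOLUTION `ψ(x) = 1∕(|x̃ − c̃|² + R²)` for
# `t·L₁ + 1` on the discrete torus (dimension `D ≥ 4`) — no Fourier analysis

Cell `pub-balaban`, β sub-cell, binder row D1, road «FP» (owner `b2b-balaban-beta-d1-p3`, «GO» journal
2026-08-21T10:09Z), lane (U2) IR-5′ (unit `b2b-balaban-beta-d1-formalise-leaf-05`, gen 17).  Third module of the
m-UNIFORM SUP LETTER of the perfect ff block (`FF-SUP-PLAN.md`): F1 `FP/CovarianceLoewnerSandwich` reduced the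
constrained covariance form to `γ₀⁻¹·Re⟨f,(Δ+1)⁻¹f⟩` (`Δ + 1 = n²L₁ + 1`), F2 `FP/TorusLaplaceComparison`
bounds `Re⟨f,(Δ+1)⁻¹f⟩` by `Σ_i f_i v_i` for any real `v` with `(n²L₁ + 1)v ≥ f`.  THIS FILE constructs `v`,
over the algebra of F3a `FP/TorusSupersolutionAlgebra`.

## The mathematics ([folklore]; `D` = number of directions = the b05 dimension, `= d+1 = 4` for the road)
On `T = Π_μ ℤ∕P_μ`, `x̃_μ = valMinAbs (x_μ)`, `s(x) := Σ_μ x̃_μ² + R²`, `ψ(x) := 1∕s(x)` (given to every theorem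
as the HYPOTHESIS `hψ : ∀ x, ψ x = 1∕(Σ_μ x̃_μ² + R²)` — no `def`), stencil `St ψ (x) := Σ_ν (2ψ(x) − ψ(x+e_ν) − ψ(x−e_ν))`.
* §3 INTERIOR points (no seam in any direction: `2|x̃_ν| + 2 < P_ν`): the neighbours' values are
  `1∕(s + 1 ± 2x̃_ν)` (`psi_add∕sub_unitVec_of_interior`), so `St ψ (x)` IS the `ℤ^D` stencil and
  `≥ 4R²∕(s+1)³ ≥ 0` (**`stencil_interior_ge`**), `≥ 4∕((D+2)³R⁴)` on the box `|x̃|∞ ≤ R` (`stencil_box_ge`).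
  BOUNDARY-LAYER points (a seam direction `ν₀`, `A := |x̃_{ν₀}| ≥ 4`): every neighbour has `ψ ≤ 1∕(s − 2|x̃_ν|)`
  and `s − 2|x̃_ν| ≥ max(A,|x̃_ν|)²∕2`, so `St ψ (x) ≥ −8D∕(A·s)` (**`stencil_boundary_ge`**) — absorbed by the mass
  once `A ≥ 8Dt`.  Together: **`supersolution_nonneg`** — `0 ≤ t·St ψ (x) + ψ(x)` at EVERY `x` — and
  **`supersolution_box`** — `t·4∕((D+2)³R⁴) ≤ t·St ψ (x) + ψ(x)` on the box — under `4 ≤ D`, `D + 2 ≤ R²`,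
  `4 ≤ R²`, `0 ≤ t`, and for every `ν`: `16·D·t + 10 ≤ P_ν` (non-negativity) ∕ `2R + 2 < P_ν` (box).
* §4 CENTRED version (`hψ : ψ x = 1∕(Σ_μ valMinAbs((x − c)_μ)² + R²)`): `stencil_centre` (the stencil commutes
  with translations), **`supersolution_nonneg_centre`**, **`supersolution_box_centre`**.

## HONEST SCOPE
Elementary; constants explicit, NOT sharp; `D ≥ 4` is used (for `D = 3` the profile would need the exponent
`½`).  The torus must be large against `t = n²` (`P_ν ≥ 16Dt + 10`): harmless for the road, whose
de-periodisation (`FP/PeriodisationBound`) sends the coarse torus to infinity at fixed `n`.  No B5 statement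
used.  0∕4 row-D1 binders; NOT hfar, NOT hRb, NOT (ASYMP), NOT D1, NOT BetaPertH, NOT continuum, NOT Clay.
HONEST DEPENDENCY: continuum YM on T⁴ ⇐ BetaPertH ∧ nine spine estimates (0/9 proved); BetaPertH ⇐ (D1) ∧ (D4) ∧
CAP+tail; G-an2-4 gates asym, D1 and NE2/3/4.
-/

noncomputable section

open scoped BigOperators

namespace Summit.QuantumFields.BalabanUV.Beta.FP.TorusSupersolution

open Literature.MathematicalPhysics.QuantumFieldTheory.Balaban1983to89.B5Prop11Plancherel
open Summit.QuantumFields.BalabanUV.Beta.FP.TorusSupersolutionAlgebra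

/-! ## §3 The supersolution with centre `0` -/

section Super

variable {D : ℕ} (P : Fin D → ℕ) [hP : ∀ ν, NeZero (P ν)] (R t : ℝ) (ψ : Tor P → ℝ)
  (hψ : ∀ x, ψ x = 1 / (∑ μ, ((x μ).valMinAbs : ℝ) ^ 2 + R ^ 2))

include hψ

/-- INTERIOR neighbours, up: `ψ(x + e_ν) = 1∕(s + 1 + 2x̃_ν)`. [folklore] -/
theorem psi_add_unitVec_of_interior (x : Tor P) (ν : Fin D)
    (hν : 2 * |((x ν).valMinAbs : ℝ)| + 2 < (P ν : ℝ)) :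
    ψ (x + unitVec P ν)
      = 1 / ((∑ μ, ((x μ).valMinAbs : ℝ) ^ 2 + R ^ 2) + 1 + 2 * ((x ν).valMinAbs : ℝ)) := by
  have hν' : 2 * |(x ν).valMinAbs| + 2 < (P ν : ℤ) := by exact_mod_cast hν
  rw [hψ, sum_sq_add_unitVec, valMinAbs_add_one _ hν']
  push_cast
  ring_nf

/-- INTERIOR neighbours, down: `ψ(x − e_ν) = 1∕(s + 1 − 2x̃_ν)`. [folklore] -/
theorem psi_sub_unitVec_of_interior (x : Tor P) (ν : Fin D)
    (hν : 2 * |((x ν).valMinAbs : ℝ)| + 2 < (P ν : ℝ)) :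
    ψ (x - unitVec P ν)
      = 1 / ((∑ μ, ((x μ).valMinAbs : ℝ) ^ 2 + R ^ 2) + 1 - 2 * ((x ν).valMinAbs : ℝ)) := by
  have hν' : 2 * |(x ν).valMinAbs| + 2 < (P ν : ℤ) := by exact_mod_cast hν
  rw [hψ, sum_sq_sub_unitVec, valMinAbs_sub_one _ hν']
  push_cast
  ring_nf

/-- **INTERIOR**: the stencil of `ψ` at a point with no seam direction IS the `ℤ^D` stencil, hence
`≥ 4R²∕(s+1)³`. [folklore] -/
theorem stencil_interior_ge (hD : 4 ≤ D) (hR : (D : ℝ) + 2 ≤ R ^ 2) (hR4 : 4 ≤ R ^ 2) (x : Tor P)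
    (hint : ∀ ν, 2 * |((x ν).valMinAbs : ℝ)| + 2 < (P ν : ℝ)) :
    4 * R ^ 2 / ((∑ μ, ((x μ).valMinAbs : ℝ) ^ 2 + R ^ 2) + 1) ^ 3
      ≤ ∑ ν, (2 * ψ x - ψ (x + unitVec P ν) - ψ (x - unitVec P ν)) := by
  have e : ∀ ν, 2 * ψ x - ψ (x + unitVec P ν) - ψ (x - unitVec P ν)
      = 2 / (∑ μ, ((x μ).valMinAbs : ℝ) ^ 2 + R ^ 2)
        - 1 / ((∑ μ, ((x μ).valMinAbs : ℝ) ^ 2 + R ^ 2) + 1 + 2 * ((x ν).valMinAbs : ℝ))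
        - 1 / ((∑ μ, ((x μ).valMinAbs : ℝ) ^ 2 + R ^ 2) + 1 - 2 * ((x ν).valMinAbs : ℝ)) := by
    intro ν
    rw [psi_add_unitVec_of_interior P R ψ hψ x ν (hint ν), psi_sub_unitVec_of_interior P R ψ hψ x ν (hint ν), hψ x]
    ring
  simp_rw [e]
  exact sum_lower hD (fun μ => ((x μ).valMinAbs : ℝ)) hR hR4

/-- **INTERIOR, box**: on `|x̃|∞ ≤ R` (with `2R + 2 < P_ν`) the stencil is `≥ 4∕((D+2)³R⁴)`. [folklore] -/
theorem stencil_box_ge (hD : 4 ≤ D) (hR : (D : ℝ) + 2 ≤ R ^ 2) (hR4 : 4 ≤ R ^ 2)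
    (hPR : ∀ ν, 2 * R + 2 < (P ν : ℝ)) (x : Tor P) (hbox : ∀ μ, |((x μ).valMinAbs : ℝ)| ≤ R) :
    4 / (((D : ℝ) + 2) ^ 3 * R ^ 4) ≤ ∑ ν, (2 * ψ x - ψ (x + unitVec P ν) - ψ (x - unitVec P ν)) := by
  have hint : ∀ ν, 2 * |((x ν).valMinAbs : ℝ)| + 2 < (P ν : ℝ) := fun ν => by
    have := hbox ν; have := hPR ν; linarith
  have e : ∀ ν, 2 * ψ x - ψ (x + unitVec P ν) - ψ (x - unitVec P ν)
      = 2 / (∑ μ, ((x μ).valMinAbs : ℝ) ^ 2 + R ^ 2)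
        - 1 / ((∑ μ, ((x μ).valMinAbs : ℝ) ^ 2 + R ^ 2) + 1 + 2 * ((x ν).valMinAbs : ℝ))
        - 1 / ((∑ μ, ((x μ).valMinAbs : ℝ) ^ 2 + R ^ 2) + 1 - 2 * ((x ν).valMinAbs : ℝ)) := by
    intro ν
    rw [psi_add_unitVec_of_interior P R ψ hψ x ν (hint ν), psi_sub_unitVec_of_interior P R ψ hψ x ν (hint ν), hψ x]
    ring
  simp_rw [e]
  exact sum_lower_box hD (fun μ => ((x μ).valMinAbs : ℝ)) hR hR4 hbox

/-- **BOUNDARY LAYER**: if some direction `ν₀` is at the seam (`P_{ν₀} ≤ 2|x̃_{ν₀}| + 2`) and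
`A := |x̃_{ν₀}| ≥ 4`, then every direction contributes `≥ −8∕(A·s)` to the stencil:
`St ψ (x) ≥ −8D∕(A·s)`. [folklore] -/
theorem stencil_boundary_ge (hP3 : ∀ ν, 3 ≤ P ν) (hR1 : 1 ≤ R ^ 2) (x : Tor P) (ν₀ : Fin D)
    (hA : 4 ≤ |((x ν₀).valMinAbs : ℝ)|) :
    -(8 * D / (|((x ν₀).valMinAbs : ℝ)| * (∑ μ, ((x μ).valMinAbs : ℝ) ^ 2 + R ^ 2)))
      ≤ ∑ ν, (2 * ψ x - ψ (x + unitVec P ν) - ψ (x - unitVec P ν)) := by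
  set a : Fin D → ℝ := fun μ => ((x μ).valMinAbs : ℝ) with ha
  set s : ℝ := ∑ μ, a μ ^ 2 + R ^ 2 with hs
  set A : ℝ := |a ν₀| with hAdef
  have hsum_ge : ∀ μ, a μ ^ 2 ≤ ∑ μ', a μ' ^ 2 := fun μ =>
    Finset.single_le_sum (fun μ' _ => sq_nonneg (a μ')) (Finset.mem_univ μ)
  have hsA : A ^ 2 + R ^ 2 ≤ s := by rw [hs, hAdef, sq_abs]; linarith [hsum_ge ν₀]
  have hs0 : 0 < s := by nlinarith
  have hA0 : 0 < A := by linarith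
  -- each direction
  have hdir : ∀ ν, -(8 / (A * s)) ≤ 2 * ψ x - ψ (x + unitVec P ν) - ψ (x - unitVec P ν) := by
    intro ν
    set B : ℝ := |a ν| with hB
    set C : ℝ := max A B with hC
    have hCA : A ≤ C := le_max_left _ _
    have hCB : B ≤ C := le_max_right _ _
    have hC4 : 4 ≤ C := hA.trans hCA
    have hsC : C ^ 2 + R ^ 2 ≤ s := by
      rcases le_total A B with hAB | hAB
      · rw [hC, max_eq_right hAB, hB, sq_abs]; rw [hs]; linarith [hsum_ge ν]
      · rw [hC, max_eq_left hAB]; exact hsA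
    have hden : C ^ 2 / 2 ≤ s - 2 * B := by nlinarith
    have hden0 : 0 < s - 2 * B := by nlinarith
    -- both neighbours: ψ ≤ 1/(s − 2B)
    have hup : ψ (x + unitVec P ν) ≤ 1 / (s - 2 * B) := by
      rw [hψ]
      have := sum_sq_add_unitVec_ge P hP3 x ν
      exact one_div_le_one_div_of_le hden0 (by rw [hs, hB, ha] at *; linarith)
    have hdn : ψ (x - unitVec P ν) ≤ 1 / (s - 2 * B) := by
      rw [hψ]
      have := sum_sq_sub_unitVec_ge P hP3 x ν
      exact one_div_le_one_div_of_le hden0 (by rw [hs, hB, ha] at *; linarith)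
    have hx : ψ x = 1 / s := by rw [hψ]
    have key : 2 * (1 / s) - 2 * (1 / (s - 2 * B)) = -(4 * B / (s * (s - 2 * B))) := by
      field_simp
      ring
    have hfrac : 4 * B / (s * (s - 2 * B)) ≤ 8 / (A * s) := by
      have hB0 : 0 ≤ B := abs_nonneg _
      calc 4 * B / (s * (s - 2 * B)) ≤ 4 * C / (s * (C ^ 2 / 2)) := by
            apply div_le_div₀ (by positivity) (by linarith) (by positivity)
            exact mul_le_mul_of_nonneg_left hden hs0.le
        _ = 8 / (C * s) := by field_simp; ring
        _ ≤ 8 / (A * s) := by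
            apply div_le_div_of_nonneg_left (by norm_num) (by positivity)
            exact mul_le_mul_of_nonneg_right hCA hs0.le
    rw [hx]
    linarith [key, hfrac, hup, hdn]
  calc -(8 * D / (A * s)) = ∑ _ν : Fin D, -(8 / (A * s)) := by
        rw [Finset.sum_const, Finset.card_univ, Fintype.card_fin, nsmul_eq_mul]; ring
    _ ≤ _ := Finset.sum_le_sum fun ν _ => hdir ν

/-- **THE SUPERSOLUTION IS NON-NEGATIVE UNDER `t·L₁ + 1` EVERYWHERE** on tori with `P_ν ≥ 16Dt + 10`.
[folklore] -/
theorem supersolution_nonneg (hD : 4 ≤ D) (hR : (D : ℝ) + 2 ≤ R ^ 2) (hR4 : 4 ≤ R ^ 2) (ht : 0 ≤ t)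
    (hPt : ∀ ν, 16 * (D : ℝ) * t + 10 ≤ (P ν : ℝ)) (x : Tor P) :
    0 ≤ t * (∑ ν, (2 * ψ x - ψ (x + unitVec P ν) - ψ (x - unitVec P ν))) + ψ x := by
  have hP3 : ∀ ν, 3 ≤ P ν := fun ν => by
    have := hPt ν
    have h16 : 0 ≤ 16 * (D : ℝ) * t := by positivity
    exact_mod_cast (show (3 : ℝ) ≤ P ν by linarith)
  have hsum_nn : 0 ≤ ∑ μ, ((x μ).valMinAbs : ℝ) ^ 2 := Finset.sum_nonneg fun μ _ => sq_nonneg _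
  have hs0 : 0 < ∑ μ, ((x μ).valMinAbs : ℝ) ^ 2 + R ^ 2 := by linarith
  have hψx : ψ x = 1 / (∑ μ, ((x μ).valMinAbs : ℝ) ^ 2 + R ^ 2) := hψ x
  have hψ0 : 0 ≤ ψ x := by rw [hψx]; positivity
  by_cases hint : ∀ ν, 2 * |((x ν).valMinAbs : ℝ)| + 2 < (P ν : ℝ)
  · have h := stencil_interior_ge P R ψ hψ hD hR hR4 x hint
    have h0 : 0 ≤ 4 * R ^ 2 / ((∑ μ, ((x μ).valMinAbs : ℝ) ^ 2 + R ^ 2) + 1) ^ 3 := by positivity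
    nlinarith
  · obtain ⟨ν₀, hν₀⟩ := not_forall.mp hint
    have hν₀' := not_lt.mp hν₀
    have h8 : 0 ≤ 8 * (D : ℝ) * t := by positivity
    have hA4 : 4 ≤ |((x ν₀).valMinAbs : ℝ)| := by have := hPt ν₀; linarith
    have hb := stencil_boundary_ge P R ψ hψ hP3 (by linarith) x ν₀ hA4
    set A : ℝ := |((x ν₀).valMinAbs : ℝ)| with hAdef
    set s : ℝ := ∑ μ, ((x μ).valMinAbs : ℝ) ^ 2 + R ^ 2 with hs
    set S : ℝ := ∑ ν, (2 * ψ x - ψ (x + unitVec P ν) - ψ (x - unitVec P ν)) with hS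
    have hA : 8 * (D : ℝ) * t + 4 ≤ A := by have := hPt ν₀; linarith
    have hA0 : 0 < A := by linarith
    -- t·(−8D/(A s)) + 1/s = (A − 8Dt)/(A s) ≥ 0
    have hkey : 0 ≤ t * (-(8 * D / (A * s))) + 1 / s := by
      have e : t * (-(8 * D / (A * s))) + 1 / s = (A - 8 * D * t) / (A * s) := by
        field_simp
        ring
      rw [e]
      exact div_nonneg (by linarith) (by positivity)
    have hmul := mul_le_mul_of_nonneg_left hb ht
    rw [hψx]
    linarith

/-- **THE SUPERSOLUTION DOMINATES `t·4∕((D+2)³R⁴)` ON THE BOX `|x̃|∞ ≤ R`** (`2R + 2 < P_ν`). [folklore] -/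
theorem supersolution_box (hD : 4 ≤ D) (hR : (D : ℝ) + 2 ≤ R ^ 2) (hR4 : 4 ≤ R ^ 2) (ht : 0 ≤ t)
    (hPR : ∀ ν, 2 * R + 2 < (P ν : ℝ)) (x : Tor P) (hbox : ∀ μ, |((x μ).valMinAbs : ℝ)| ≤ R) :
    t * (4 / (((D : ℝ) + 2) ^ 3 * R ^ 4))
      ≤ t * (∑ ν, (2 * ψ x - ψ (x + unitVec P ν) - ψ (x - unitVec P ν))) + ψ x := by
  have h := stencil_box_ge P R ψ hψ hD hR hR4 hPR x hbox
  have hsum_nn : 0 ≤ ∑ μ, ((x μ).valMinAbs : ℝ) ^ 2 := Finset.sum_nonneg fun μ _ => sq_nonneg _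
  have hψ0 : 0 ≤ ψ x := by rw [hψ x]; positivity
  nlinarith [mul_le_mul_of_nonneg_left h ht]

end Super

/-! ## §4 Centred version -/

section Centre

variable {D : ℕ} (P : Fin D → ℕ) [hP : ∀ ν, NeZero (P ν)] (R t : ℝ) (c : Tor P) (ψ : Tor P → ℝ)
  (hψ : ∀ x, ψ x = 1 / (∑ μ, (((x - c) μ).valMinAbs : ℝ) ^ 2 + R ^ 2))

include hψ

omit hP in
/-- the centred `ψ` is the centre-`0` profile composed with `x ↦ x − c`. [folklore] -/
theorem psi_centre_eq : ∀ y, (fun z => ψ (z + c)) y = 1 / (∑ μ, ((y μ).valMinAbs : ℝ) ^ 2 + R ^ 2) := by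
  intro y
  simp only [hψ, add_sub_cancel_right]

omit hP hψ in
/-- the stencil commutes with the translation. [folklore] -/
theorem stencil_centre (x : Tor P) :
    ∑ ν, (2 * ψ x - ψ (x + unitVec P ν) - ψ (x - unitVec P ν))
      = ∑ ν, (2 * (fun z => ψ (z + c)) (x - c) - (fun z => ψ (z + c)) ((x - c) + unitVec P ν)
          - (fun z => ψ (z + c)) ((x - c) - unitVec P ν)) := by
  refine Finset.sum_congr rfl fun ν _ => ?_
  have e1 : x - c + c = x := sub_add_cancel x c
  have e2 : x - c + unitVec P ν + c = x + unitVec P ν := by abel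
  have e3 : x - c - unitVec P ν + c = x - unitVec P ν := by abel
  simp only [e1, e2, e3]

/-- **CENTRED SUPERSOLUTION, non-negativity everywhere**. [folklore] -/
theorem supersolution_nonneg_centre (hD : 4 ≤ D) (hR : (D : ℝ) + 2 ≤ R ^ 2) (hR4 : 4 ≤ R ^ 2) (ht : 0 ≤ t)
    (hPt : ∀ ν, 16 * (D : ℝ) * t + 10 ≤ (P ν : ℝ)) (x : Tor P) :
    0 ≤ t * (∑ ν, (2 * ψ x - ψ (x + unitVec P ν) - ψ (x - unitVec P ν))) + ψ x := by
  have h := supersolution_nonneg P R t (fun z => ψ (z + c)) (psi_centre_eq P R c ψ hψ) hD hR hR4 ht hPt (x - c)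
  rw [stencil_centre P c ψ x]
  simpa only [sub_add_cancel] using h

/-- **CENTRED SUPERSOLUTION, box bound** on `|valMinAbs (x − c)|∞ ≤ R`. [folklore] -/
theorem supersolution_box_centre (hD : 4 ≤ D) (hR : (D : ℝ) + 2 ≤ R ^ 2) (hR4 : 4 ≤ R ^ 2) (ht : 0 ≤ t)
    (hPR : ∀ ν, 2 * R + 2 < (P ν : ℝ)) (x : Tor P) (hbox : ∀ μ, |(((x - c) μ).valMinAbs : ℝ)| ≤ R) :
    t * (4 / (((D : ℝ) + 2) ^ 3 * R ^ 4))
      ≤ t * (∑ ν, (2 * ψ x - ψ (x + unitVec P ν) - ψ (x - unitVec P ν))) + ψ x := by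
  have h := supersolution_box P R t (fun z => ψ (z + c)) (psi_centre_eq P R c ψ hψ) hD hR hR4 ht hPR (x - c) hbox
  rw [stencil_centre P c ψ x]
  simpa only [sub_add_cancel] using h

end Centre

end Summit.QuantumFields.BalabanUV.Beta.FP.TorusSupersolution
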